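import Mathlib
import HarnessLib
import Literature.Probability.Distributions.BrascampLiebMomentAux

/-!
# LatticeQCDFlow / Scaling — the first absolute moment in the central limit theorem:
# `E|Σ_{i<n} D(yᵢ)|/√n → √(2·Var D/π)` for the rows of a product family

HONEST FRAMING: exact (Metropolis-corrected) sampling algorithms for lattice gauge theory;
figures of merit are autocorrelation/cost numbers at stated couplings and volumes; no
continuum-physics claim.

Venture `LatticeQCDFlow` (cell pub-lqcd), topic `Scaling`; FANOUT row 3 (`s0-u1-a`, S0-B
implementation A, GEN-19).  NEW WORK of the cell (elementary probability assembled on Mathlib's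
central limit theorem — `ProbabilityTheory.tendsto_charFun_inv_sqrt_mul_pow` — and Lévy's
convergence theorem `ProbabilityMeasure.tendsto_iff_tendsto_charFun`); NO definition is introduced;
nothing is cited as a fact (the half-line Gaussian moment is the Literature's
`setIntegral_Ioi_id_mul_gauss`, Gradshteyn–Ryzhik 3.326.2, file `BrascampLiebMomentAux`).
Printed counterpart NAMED ONLY: the convergence of absolute moments in the central limit theorem is
classical (von Bahr, *Ann. Math. Statist.* 36 (1965) 808–818; DasGupta, *Asymptotic Theory of
Statistics and Probability* (2008) §6); the uniform-integrability route below is ours.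

Purpose: the tool behind the exact large-volume constant `σ/√π` of the strong-coupling acceptance
slope of the untrained factorised sampler (`Scaling/GiniMeanDifferenceCLT`, which reads this file on
two independent copies); row 3's GEN-18 sandwich `σ√(V/6) ≤ s_V ≤ σ√(V/3)` left it NOT CLAIMED.

## Content (all `[ours]`)

* §1 `integral_comp_boundedContinuous_tendsto_of_tendstoInDistribution` (convergence in
  distribution tested on a bounded continuous function, statistics on VARYING spaces);
  `abs_sub_min_abs_le_sq_div`, `abs_integral_abs_sub_integral_min_le` (truncation tail
  `E|Y| − E min(|Y|, M) ≤ E Y²/M`); **`tendsto_integral_abs_of_tendstoInDistribution`** —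
  `Xₙ ⇒ Z`, `E Xₙ² ≤ C`, `E Z² ≤ C` ⇒ `E|Xₙ| → E|Z|`.
* §2 **`integral_abs_gaussianReal`** — `∫|x| dN(0, v) = √(2v/π)`.
* §3 `pi_map_comp_eval`, `pi_charFun_inv_sqrt_mul_sum`,
  **`pi_tendstoInDistribution_inv_sqrt_mul_sum`** — the CLT for the ROWS `(Fin n → Y, ρ^{⊗n})`:
  `(√n)⁻¹ Σᵢ D(yᵢ) ⇒ N(0, Var D)` for `D ∈ L²(ρ)` centred (no ambient sequence space needed).
* §4 `pi_integral_sum_sq` (`E(Σᵢ D(yᵢ))² = n·Var D`), `pi_integral_inv_sqrt_mul_sum_sq_le`,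
  **`pi_integral_abs_sum_div_sqrt_tendsto`** — `E|Σᵢ D(yᵢ)|/√n → √(2·Var D/π)`.

NOT CLAIMED: rates (Berry–Esseen); dependent coordinates; vector statistics; any value at the
cell's `(β, L)`; nothing re-scored.
-/

noncomputable section

namespace Summit.Ventures.LatticeQCDFlow.Theory2

open MeasureTheory ProbabilityTheory Filter Finset Real Set
open scoped Topology NNReal BoundedContinuousFunction

/-! ## §1 Convergence in distribution with bounded second moments -/

section UniformIntegrability

variable {Ω : ℕ → Type*} {mΩ : ∀ n, MeasurableSpace (Ω n)} {P : (n : ℕ) → Measure (Ω n)}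
  [∀ n, IsProbabilityMeasure (P n)]
variable {Ω' : Type*} {mΩ' : MeasurableSpace Ω'} {P' : Measure Ω'} [IsProbabilityMeasure P']

/-- Convergence in distribution tested on a bounded continuous function (statistics on varying
probability spaces). [ours] -/
theorem integral_comp_boundedContinuous_tendsto_of_tendstoInDistribution
    {X : (n : ℕ) → Ω n → ℝ} {Z : Ω' → ℝ} (h : TendstoInDistribution X atTop Z P P')
    (f : ℝ →ᵇ ℝ) :
    Tendsto (fun n => ∫ ω, f (X n ω) ∂P n) atTop (𝓝 (∫ ω, f (Z ω) ∂P')) := by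
  have key := (ProbabilityMeasure.tendsto_iff_forall_integral_tendsto.1 h.tendsto) f
  simp only [ProbabilityMeasure.coe_mk] at key
  rw [integral_map h.aemeasurable_limit f.continuous.aestronglyMeasurable] at key
  refine key.congr fun n => ?_
  rw [integral_map (h.forall_aemeasurable n) f.continuous.aestronglyMeasurable]

/-- The tail of the truncation at level `M`: `0 ≤ |t| − min(|t|, M) ≤ t²/M` (`M > 0`). [ours] -/
theorem abs_sub_min_abs_le_sq_div {M : ℝ} (hM : 0 < M) (t : ℝ) :
    0 ≤ |t| - min |t| M ∧ |t| - min |t| M ≤ t ^ 2 / M := by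
  refine ⟨sub_nonneg.2 (min_le_left _ _), ?_⟩
  rcases le_or_gt |t| M with h | h
  · rw [min_eq_left h, sub_self]
    positivity
  · rw [min_eq_right h.le]
    have h1 : |t| - M ≤ |t| := by linarith
    have h2 : |t| ≤ t ^ 2 / M := by
      rw [le_div_iff₀ hM, ← sq_abs, sq]
      exact mul_le_mul_of_nonneg_left h.le (abs_nonneg t)
    exact h1.trans h2

/-- The tail estimate of the truncation: for a square-integrable statistic on a probability
space, `0 ≤ E|Y| − E min(|Y|, M) ≤ E Y²/M`. [ours] -/
theorem abs_integral_abs_sub_integral_min_le {Ω₀ : Type*} {m₀ : MeasurableSpace Ω₀}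
    (μ : Measure Ω₀) [IsProbabilityMeasure μ] {Y : Ω₀ → ℝ} (hY : MemLp Y 2 μ) {M : ℝ}
    (hM : 0 < M) :
    |∫ ω, |Y ω| ∂μ - ∫ ω, min |Y ω| M ∂μ| ≤ (∫ ω, Y ω ^ 2 ∂μ) / M := by
  have hYi : Integrable (fun ω => |Y ω|) μ := (hY.integrable one_le_two).abs
  have hfi : Integrable (fun ω => min |Y ω| M) μ := by
    refine hYi.mono' (hYi.aestronglyMeasurable.inf aestronglyMeasurable_const)
      (Filter.Eventually.of_forall fun ω => ?_)
    rw [Real.norm_eq_abs, abs_of_nonneg (le_min (abs_nonneg _) hM.le)]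
    exact min_le_left _ _
  rw [← integral_sub hYi hfi]
  have h1 : 0 ≤ ∫ ω, (|Y ω| - min |Y ω| M) ∂μ :=
    integral_nonneg fun ω => (abs_sub_min_abs_le_sq_div hM (Y ω)).1
  rw [abs_of_nonneg h1]
  calc ∫ ω, (|Y ω| - min |Y ω| M) ∂μ ≤ ∫ ω, Y ω ^ 2 / M ∂μ :=
        integral_mono_of_nonneg (Filter.Eventually.of_forall fun ω =>
          (abs_sub_min_abs_le_sq_div hM (Y ω)).1) (hY.integrable_sq.div_const M)
          (Filter.Eventually.of_forall fun ω => (abs_sub_min_abs_le_sq_div hM (Y ω)).2)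
    _ = (∫ ω, Y ω ^ 2 ∂μ) / M := integral_div M _

/-- **CONVERGENCE IN DISTRIBUTION WITH BOUNDED SECOND MOMENTS GIVES CONVERGENCE OF THE FIRST ABSOLUTE
MOMENT**: `Xₙ ⇒ Z`, `E Xₙ² ≤ C`, `E Z² ≤ C` ⇒ `E|Xₙ| → E|Z|`. [ours] -/
theorem tendsto_integral_abs_of_tendstoInDistribution
    {X : (n : ℕ) → Ω n → ℝ} {Z : Ω' → ℝ} (h : TendstoInDistribution X atTop Z P P')
    {C : ℝ} (hX : ∀ n, MemLp (X n) 2 (P n)) (hXC : ∀ n, ∫ ω, X n ω ^ 2 ∂P n ≤ C)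
    (hZ : MemLp Z 2 P') (hZC : ∫ ω, Z ω ^ 2 ∂P' ≤ C) :
    Tendsto (fun n => ∫ ω, |X n ω| ∂P n) atTop (𝓝 (∫ ω, |Z ω| ∂P')) := by
  have hC0 : 0 ≤ C := (integral_nonneg fun ω => sq_nonneg (Z ω)).trans hZC
  rw [Metric.tendsto_atTop]
  intro ε hε
  -- truncation level
  set M : ℝ := 3 * C / ε + 1 with hMdef
  have hM : 0 < M := by positivity
  have hCM : C / M < ε / 3 := by
    rw [div_lt_iff₀ hM, hMdef]
    have : ε / 3 * (3 * C / ε + 1) = C + ε / 3 := by field_simp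
    rw [this]
    linarith
  -- the bounded continuous test function `t ↦ min |t| M`
  let f : ℝ →ᵇ ℝ := BoundedContinuousFunction.mkOfBound
    ⟨fun t => min |t| M, continuous_abs.min continuous_const⟩ M (by
      intro x y
      simp only [ContinuousMap.coe_mk, Real.dist_eq]
      have hx : 0 ≤ min |x| M := le_min (abs_nonneg _) hM.le
      have hy : 0 ≤ min |y| M := le_min (abs_nonneg _) hM.le
      have hx' : min |x| M ≤ M := min_le_right _ _
      have hy' : min |y| M ≤ M := min_le_right _ _
      rw [abs_le]
      constructor <;> linarith)
  have hf : ∀ t, f t = min |t| M := fun t => rfl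
  -- weak convergence on the test function
  have hmid := integral_comp_boundedContinuous_tendsto_of_tendstoInDistribution h f
  rw [Metric.tendsto_atTop] at hmid
  obtain ⟨N, hN⟩ := hmid (ε / 3) (by positivity)
  refine ⟨N, fun n hn => ?_⟩
  have e1 : |∫ ω, |X n ω| ∂P n - ∫ ω, f (X n ω) ∂P n| ≤ C / M :=
    (abs_integral_abs_sub_integral_min_le (P n) (hX n) hM).trans
      (div_le_div_of_nonneg_right (hXC n) hM.le)
  have e2 := hN n hn
  have e3 : |∫ ω, |Z ω| ∂P' - ∫ ω, f (Z ω) ∂P'| ≤ C / M :=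
    (abs_integral_abs_sub_integral_min_le P' hZ hM).trans
      (div_le_div_of_nonneg_right hZC hM.le)
  rw [Real.dist_eq] at e2 ⊢
  have := abs_sub_le (∫ ω, |X n ω| ∂P n) (∫ ω, f (X n ω) ∂P n) (∫ ω, |Z ω| ∂P')
  have := abs_sub_le (∫ ω, f (X n ω) ∂P n) (∫ ω, f (Z ω) ∂P') (∫ ω, |Z ω| ∂P')
  rw [abs_sub_comm] at e3
  linarith

end UniformIntegrability

/-! ## §2 The half-normal mean -/

section HalfNormal

/-- **`∫|x| dN(0, v) = √(2v/π)`** — the mean absolute value of a centred Gaussian. [ours] -/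
theorem integral_abs_gaussianReal (v : ℝ≥0) :
    ∫ x, |x| ∂(gaussianReal 0 v) = Real.sqrt (2 * v / π) := by
  rcases eq_or_ne v 0 with hv | hv
  · subst hv
    simp [gaussianReal_zero_var]
  have hvpos : (0 : ℝ) < v := lt_of_le_of_ne v.2 (fun h => hv (by exact_mod_cast h.symm))
  set b : ℝ := (2 * (v : ℝ))⁻¹ with hb
  have hbpos : 0 < b := by positivity
  rw [integral_gaussianReal_eq_integral_smul hv]
  simp only [gaussianPDFReal_def, sub_zero, smul_eq_mul]
  have e1 : ∀ x : ℝ, (Real.sqrt (2 * π * v))⁻¹ * rexp (-x ^ 2 / (2 * v)) * |x|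
      = (Real.sqrt (2 * π * v))⁻¹ * (|x| * rexp (-b * |x| ^ 2)) := fun x => by
    rw [sq_abs, hb]
    have : -x ^ 2 / (2 * (v : ℝ)) = -(2 * (v : ℝ))⁻¹ * x ^ 2 := by
      field_simp
    rw [this]; ring
  simp_rw [e1]
  rw [integral_const_mul, integral_comp_abs (f := fun t => t * rexp (-b * t ^ 2))]
  have hI := Literature.Probability.Distributions.setIntegral_Ioi_id_mul_gauss hbpos 0
  simp only [ne_eq, OfNat.ofNat_ne_zero, not_false_eq_true, zero_pow, mul_zero, Real.exp_zero]
    at hI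
  rw [hI, hb]
  have h2v : (0 : ℝ) ≤ 2 * v := by positivity
  rw [show (2 : ℝ) * (1 / (2 * (2 * (v : ℝ))⁻¹)) = 2 * v by field_simp]
  rw [show (Real.sqrt (2 * π * v))⁻¹ * (2 * (v : ℝ)) = Real.sqrt ((2 * v) ^ 2) / Real.sqrt (2 * π * v)
    by rw [Real.sqrt_sq h2v]; ring]
  rw [← Real.sqrt_div (sq_nonneg _)]
  congr 1
  field_simp

end HalfNormal

/-! ## §3 The central limit theorem for the rows of a product family -/

section PiCLT

variable {Y : Type*} {mY : MeasurableSpace Y} {ρ : Measure Y} [IsProbabilityMeasure ρ] {D : Y → ℝ}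
variable {Ω' : Type*} {mΩ' : MeasurableSpace Ω'} {P' : Measure Ω'} [IsProbabilityMeasure P']

/-- Coordinates of a `Measure.pi` row: `y ↦ D (y i)` is a.e.-measurable with law `ρ ∘ D⁻¹`. [ours] -/
theorem pi_aemeasurable_comp_eval (hD : AEMeasurable D ρ) (n : ℕ) (i : Fin n) :
    AEMeasurable (fun y : Fin n → Y => D (y i)) (Measure.pi fun _ : Fin n => ρ) :=
  hD.comp_quasiMeasurePreserving (Measure.quasiMeasurePreserving_eval _ i)

/-- The marginal law of a coordinate statistic of a `Measure.pi` row. [ours] -/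
theorem pi_map_comp_eval (hD : AEMeasurable D ρ) (n : ℕ) (i : Fin n) :
    (Measure.pi fun _ : Fin n => ρ).map (fun y : Fin n → Y => D (y i)) = ρ.map D := by
  have h : (Measure.pi fun _ : Fin n => ρ).map (Function.eval i) = ρ :=
    (measurePreserving_eval (fun _ : Fin n => ρ) i).map_eq
  have hD' : AEMeasurable D ((Measure.pi fun _ : Fin n => ρ).map (Function.eval i)) := by
    rw [h]; exact hD
  have key := AEMeasurable.map_map_of_aemeasurable hD' (measurable_pi_apply i).aemeasurable
  rw [h] at key
  exact key.symm

/-- The characteristic function of the normalised row sum is the `n`-th power. [ours] -/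
theorem pi_charFun_inv_sqrt_mul_sum (hD : AEMeasurable D ρ) (n : ℕ) (t : ℝ) :
    charFun ((Measure.pi fun _ : Fin n => ρ).map
        (fun y : Fin n → Y => (Real.sqrt n)⁻¹ * ∑ i, D (y i))) t
      = (charFun (ρ.map D) ((Real.sqrt n)⁻¹ * t)) ^ n := by
  have mX : ∀ i : Fin n, AEMeasurable (fun y : Fin n → Y => D (y i)) (Measure.pi fun _ : Fin n => ρ) :=
    pi_aemeasurable_comp_eval hD n
  rw [charFun_map_mul_comp (Finset.aemeasurable_fun_sum _ fun i _ => mX i)]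
  have hind : iIndepFun (fun (i : Fin n) (y : Fin n → Y) => D (y i)) (Measure.pi fun _ : Fin n => ρ) :=
    iIndepFun_pi fun _ => hD
  rw [hind.charFun_map_fun_sum_eq_prod mX]
  simp only [Finset.prod_apply, pi_map_comp_eval hD, Finset.prod_const, Finset.card_univ,
    Fintype.card_fin]

/-- **THE CENTRAL LIMIT THEOREM FOR THE ROWS OF A PRODUCT FAMILY.**  For a probability law `ρ` and a
centred square-integrable statistic `D`, the normalised row sums `(√n)⁻¹ Σ_{i<n} D(yᵢ)` on the
product spaces `(Fin n → Y, ρ^{⊗n})` converge in distribution to `N(0, Var D)`. [ours]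
(Mathlib's `tendsto_charFun_inv_sqrt_mul_pow` + Lévy; no ambient sequence space is needed.) -/
theorem pi_tendstoInDistribution_inv_sqrt_mul_sum (hD : MemLp D 2 ρ) (h0 : ∫ y, D y ∂ρ = 0)
    {Z : Ω' → ℝ} (hZ : HasLaw Z (gaussianReal 0 (Var[D; ρ]).toNNReal) P') :
    TendstoInDistribution (fun (n : ℕ) (y : Fin n → Y) => (Real.sqrt n)⁻¹ * ∑ i, D (y i)) atTop Z
      (fun n => Measure.pi fun _ : Fin n => ρ) P' where
  forall_aemeasurable n := (Finset.aemeasurable_fun_sum _ fun i _ =>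
    pi_aemeasurable_comp_eval hD.aestronglyMeasurable.aemeasurable n i).const_mul _
  aemeasurable_limit := hZ.aemeasurable
  tendsto := by
    have mD : AEMeasurable D ρ := hD.aestronglyMeasurable.aemeasurable
    refine ProbabilityMeasure.tendsto_iff_tendsto_charFun.2 fun t => ?_
    simp only [ProbabilityMeasure.coe_mk, pi_charFun_inv_sqrt_mul_sum mD, hZ.map_eq,
      charFun_gaussianReal, Complex.ofReal_zero, mul_zero, zero_mul, zero_sub]
    set v : ℝ := Var[D; ρ] with hv
    have hv0 : 0 ≤ v := variance_nonneg _ _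
    have hvar : ∫ y, D y ^ 2 ∂ρ = v := by
      rw [hv, variance_eq_integral mD, h0]
      simp
    rcases eq_or_ne v 0 with hz | hz
    · -- degenerate case: `D = 0` a.e., both sides are the Dirac mass at `0`
      have hD0 : D =ᵐ[ρ] (fun _ => 0) := by
        have h2 : ∫ y, D y ^ 2 ∂ρ = 0 := by rw [hvar, hz]
        have := (integral_eq_zero_iff_of_nonneg (fun y => sq_nonneg (D y)) hD.integrable_sq).1 h2
        filter_upwards [this] with y hy
        simpa using hy
      have hmap : ρ.map D = Measure.dirac 0 := by
        rw [Measure.map_congr hD0, Measure.map_const, measure_univ, one_smul]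
      have hconst : ∀ s : ℝ, charFun (Measure.dirac (0 : ℝ)) s = 1 := fun s => by
        rw [charFun_dirac, inner_zero_left]
        simp
      simp only [hmap, hconst, one_pow, hz, Real.toNNReal_zero, NNReal.coe_zero,
        Complex.ofReal_zero, neg_zero, zero_mul, zero_div, Complex.exp_zero]
      exact tendsto_const_nhds
    · -- standardise and use Mathlib's characteristic-function limit
      have hvpos : 0 < v := lt_of_le_of_ne hv0 (Ne.symm hz)
      have hsv : 0 < Real.sqrt v := Real.sqrt_pos.2 hvpos
      set D' : Y → ℝ := fun y => D y / Real.sqrt v with hD'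
      have mD' : AEMeasurable D' ρ := mD.div_const _
      have h0' : ∫ y, D' y ∂ρ = 0 := by
        simp only [hD', integral_div, h0, zero_div]
      have h1' : ∫ y, (D' ^ 2) y ∂ρ = 1 := by
        simp only [hD', Pi.pow_apply, div_pow, Real.sq_sqrt hv0, integral_div, hvar]
        exact div_self hz
      have e : ∀ n : ℕ, charFun (ρ.map D) ((Real.sqrt n)⁻¹ * t)
          = charFun (ρ.map D') ((Real.sqrt n)⁻¹ * (Real.sqrt v * t)) := fun n => by
        have : D = fun y => Real.sqrt v * D' y := by
          funext y; simp only [hD']; field_simp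
        rw [this, charFun_map_mul_comp mD']
        ring_nf
      simp_rw [e]
      have key := tendsto_charFun_inv_sqrt_mul_pow (P := ρ) mD' h0' h1' (Real.sqrt v * t)
      have hlim : Complex.exp (-(↑(Real.sqrt v * t) : ℂ) ^ 2 / 2)
          = Complex.exp (-(↑((v.toNNReal : ℝ≥0) : ℝ) * (t : ℂ) ^ 2 / 2)) := by
        rw [Real.coe_toNNReal v hv0]
        push_cast
        rw [mul_pow, ← Complex.ofReal_pow, Real.sq_sqrt hv0]
        ring_nf
      rw [← hlim]
      exact key

end PiCLT

/-! ## §4 The first absolute moment of the row sums -/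

section RowMoments

variable {Y : Type*} {mY : MeasurableSpace Y} {ρ : Measure Y} [IsProbabilityMeasure ρ] {D : Y → ℝ}

/-- The row-sum statistic `y ↦ Σᵢ D(yᵢ)` is square integrable. [ours] -/
theorem pi_memLp_sum (hD : MemLp D 2 ρ) (n : ℕ) :
    MemLp (fun y : Fin n → Y => ∑ i, D (y i)) 2 (Measure.pi fun _ : Fin n => ρ) :=
  memLp_finsetSum _ fun i _ => hD.comp_measurePreserving (measurePreserving_eval _ i)

/-- The row sum of a centred statistic is centred. [ours] -/
theorem pi_integral_sum_eq_zero (hD : MemLp D 2 ρ) (h0 : ∫ y, D y ∂ρ = 0) (n : ℕ) :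
    ∫ y, ∑ i, D (y i) ∂(Measure.pi fun _ : Fin n => ρ) = 0 := by
  have hint : ∀ i : Fin n,
      Integrable (fun y : Fin n → Y => D (y i)) (Measure.pi fun _ : Fin n => ρ) := fun i =>
    ((measurePreserving_eval (fun _ : Fin n => ρ) i).integrable_comp hD.aestronglyMeasurable).2
      (hD.integrable one_le_two)
  rw [integral_finsetSum _ fun i _ => hint i]
  refine Finset.sum_eq_zero fun i _ => ?_
  have hlaw := (measurePreserving_eval (fun _ : Fin n => ρ) i).map_eq
  have him := integral_map (μ := Measure.pi fun _ : Fin n => ρ)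
    (measurable_pi_apply i).aemeasurable (f := D) (by rw [hlaw]; exact hD.aestronglyMeasurable)
  rw [hlaw] at him
  rw [← him, h0]

/-- **`E(Σᵢ D(yᵢ))² = n·Var D`** for a centred square-integrable `D` under `ρ^{⊗n}`. [ours]
(Mathlib's `variance_sum_pi`.) -/
theorem pi_integral_sum_sq (hD : MemLp D 2 ρ) (h0 : ∫ y, D y ∂ρ = 0) (n : ℕ) :
    ∫ y, (∑ i, D (y i)) ^ 2 ∂(Measure.pi fun _ : Fin n => ρ) = n * Var[D; ρ] := by
  have hS := pi_memLp_sum hD n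
  have hvar := variance_eq_sub hS
  have hmean := pi_integral_sum_eq_zero hD h0 n
  simp only [hmean, ne_eq, OfNat.ofNat_ne_zero, not_false_eq_true, zero_pow, sub_zero] at hvar
  have hpi := variance_sum_pi (μ := fun _ : Fin n => ρ) (X := fun (_ : Fin n) => D) fun _ => hD
  simp only [Finset.sum_const, Finset.card_univ, Fintype.card_fin, nsmul_eq_mul] at hpi
  have e : (∑ _i : Fin n, fun ω : Fin n → Y => D (ω _i)) = fun y => ∑ i, D (y i) := by
    funext y; simp [Finset.sum_apply]
  rw [e, hvar] at hpi
  rw [← hpi]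
  rfl

/-- `E((√n)⁻¹ Σᵢ D(yᵢ))² ≤ Var D` (equality for `n ≥ 1`). [ours] -/
theorem pi_integral_inv_sqrt_mul_sum_sq_le (hD : MemLp D 2 ρ) (h0 : ∫ y, D y ∂ρ = 0) (n : ℕ) :
    ∫ y, ((Real.sqrt n)⁻¹ * ∑ i, D (y i)) ^ 2 ∂(Measure.pi fun _ : Fin n => ρ) ≤ Var[D; ρ] := by
  have e : ∀ y : Fin n → Y, ((Real.sqrt n)⁻¹ * ∑ i, D (y i)) ^ 2 = (n : ℝ)⁻¹ * (∑ i, D (y i)) ^ 2 :=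
    fun y => by rw [mul_pow, inv_pow, Real.sq_sqrt (Nat.cast_nonneg n)]
  simp_rw [e]
  rw [integral_const_mul, pi_integral_sum_sq hD h0]
  rcases Nat.eq_zero_or_pos n with hn | hn
  · subst hn
    simp only [Nat.cast_zero, inv_zero, zero_mul]
    exact variance_nonneg _ _
  · rw [← mul_assoc, inv_mul_cancel₀ (by positivity), one_mul]

/-- **THE FIRST ABSOLUTE MOMENT IN THE CENTRAL LIMIT THEOREM**: for a centred square-integrable
statistic `D` under the product laws `ρ^{⊗n}`, `E|Σ_{i<n} D(yᵢ)|/√n → √(2·Var D/π)` — the mean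
absolute value of the Gaussian limit. [ours] -/
theorem pi_integral_abs_sum_div_sqrt_tendsto (hD : MemLp D 2 ρ) (h0 : ∫ y, D y ∂ρ = 0) :
    Tendsto (fun n : ℕ => (∫ y, |∑ i, D (y i)| ∂(Measure.pi fun _ : Fin n => ρ)) / Real.sqrt n)
      atTop (𝓝 (Real.sqrt (2 * Var[D; ρ] / π))) := by
  set v : ℝ := Var[D; ρ] with hv
  have hv0 : 0 ≤ v := variance_nonneg _ _
  have hZ : HasLaw (id : ℝ → ℝ) (gaussianReal 0 v.toNNReal) (gaussianReal 0 v.toNNReal) :=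
    ⟨aemeasurable_id, Measure.map_id⟩
  have hclt := pi_tendstoInDistribution_inv_sqrt_mul_sum (P' := gaussianReal 0 v.toNNReal) hD h0 hZ
  have hZ2 : MemLp (id : ℝ → ℝ) 2 (gaussianReal 0 v.toNNReal) := memLp_id_gaussianReal 2
  have hZC : ∫ x, (id x : ℝ) ^ 2 ∂(gaussianReal 0 v.toNNReal) ≤ v := by
    have h := variance_eq_sub hZ2
    rw [variance_id_gaussianReal, Real.coe_toNNReal v hv0] at h
    simp only [id_eq, Pi.pow_apply] at h
    rw [integral_id_gaussianReal] at h
    simp only [ne_eq, OfNat.ofNat_ne_zero, not_false_eq_true, zero_pow, sub_zero] at h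
    simp only [id_eq]
    exact le_of_eq h.symm
  have key := tendsto_integral_abs_of_tendstoInDistribution hclt (C := v)
    (fun n => (pi_memLp_sum hD n).const_mul _) (fun n => pi_integral_inv_sqrt_mul_sum_sq_le hD h0 n)
    hZ2 hZC
  simp only [id_eq, integral_abs_gaussianReal, Real.coe_toNNReal v hv0] at key
  refine key.congr fun n => ?_
  have e : ∀ y : Fin n → Y, |(Real.sqrt n)⁻¹ * ∑ i, D (y i)| = (Real.sqrt n)⁻¹ * |∑ i, D (y i)| :=
    fun y => by rw [abs_mul, abs_of_nonneg (inv_nonneg.2 (Real.sqrt_nonneg _))]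
  simp_rw [e]
  rw [integral_const_mul, div_eq_inv_mul]

end RowMoments

end Summit.Ventures.LatticeQCDFlow.Theory2

end
namespace Summit.Ventures.LatticeQCDFlow.Theory2
open MeasureTheory ProbabilityTheory in
/-- **Finite-`n` companion** (Cauchy–Schwarz): `∫|Σᵢ D(yᵢ)| dρ^{⊗n} ≤ √(n·Var D)` for all `n`. -/
theorem pi_integral_abs_sum_le_sqrt {Y : Type*} {mY : MeasurableSpace Y} {ρ : Measure Y}
    [IsProbabilityMeasure ρ] {D : Y → ℝ} (hD : MemLp D 2 ρ) (h0 : ∫ y, D y ∂ρ = 0) (n : ℕ) :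
    ∫ y, |∑ i, D (y i)| ∂(Measure.pi fun _ : Fin n => ρ) ≤ Real.sqrt (n * Var[D; ρ]) := by
  have hA : MemLp (fun y : Fin n → Y => |∑ i, D (y i)|) 2 (Measure.pi fun _ : Fin n => ρ) := (pi_memLp_sum hD n).abs
  have h1 := variance_nonneg (fun y : Fin n → Y => |∑ i, D (y i)|) (Measure.pi fun _ : Fin n => ρ)
  rw [variance_eq_sub hA] at h1
  simp only [Pi.pow_apply, sq_abs, pi_integral_sum_sq hD h0 n, sub_nonneg] at h1
  exact Real.le_sqrt_of_sq_le h1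
end Summit.Ventures.LatticeQCDFlow.Theory2
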